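import Literature.Probability.RandomPlanarGeometry.LoewnerThrTip
import Literature.Probability.RandomPlanarGeometry.LoewnerClusterSwallow
import HarnessLib

/-!
# The through-swallow tip identity while the curve stays `δ`-far from the hull

Topic `Probability/RandomPlanarGeometry`; theorems only (crux `stmt-CriticalPhenomena-0698`, stub
`stub_isLocal`, (D) of the through-swallow programme of the locality of SLE₆: G. F. Lawler (2005),
§6.3 Thm. 6.13; Lawler–Schramm–Werner (2003), §5). The hypotheses of
`thr_apply_clockC_eq_of_finite` (`LoewnerThrTip`: the remaining hull `A ∖ K̂_t` closed for
`t ≤ β`, finitely many remaining hulls on `[0, β]`, the curve avoiding `A`) all follow from "the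
generating curve stays `δ`-far from `A` on `[0, β]`" for a cluster scale `0 < δ ≤ dist(0, A)`
(`LoewnerClusterSwallow`: the swallowed part is then a union of the finitely many `δ`-clusters of `A`):

* `remHull_eq_diff_sUnion_of_far` — `A ∖ K̂_t = A ∖ ⋃ {δ-clusters ⊆ K̂_t}`;
* `finite_image_remHull_of_far` — hence `t ↦ A ∖ K̂_t` takes finitely many values on `[0, β]`;
* **`thr_apply_clockC_eq_of_far`** — `γ̂ (σ t) = E_A (γ t)` for `t ≤ β₂ < β` under the `δ`-far
  hypothesis on `[0, β]`.
-/

noncomputable section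

open Set Filter Topology Function Complex Metric
open UpperHalfPlane (upperHalfPlaneSet)
open scoped NNReal

namespace Literature.Probability.RandomPlanarGeometry

namespace Loewner

variable {W : ℝ≥0 → ℝ} {A : Set ℂ} {γ : ℝ≥0 → ℂ} {δ : ℝ}

section Far

variable (hγ : IsGeneratedByCurve W γ) (hW : Continuous W) (hW0 : W 0 = 0) (hA : IsStarHull A)
  (hδ : 0 < δ) (h0 : δ ≤ infDist (0 : ℂ) A)
include hγ hW hW0 hA hδ h0

/-- **While the curve is `δ`-far from `A`, the remaining hull is `A` minus the swallowed `δ`-clusters.**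
[cite: Lawler2005, §6.3 Thm. 6.13] -/
theorem remHull_eq_diff_sUnion_of_far {t : ℝ≥0} (hfar : ∀ s ≤ t, δ ≤ infDist (γ s) A) :
    remHull W A t = A \ ⋃₀ {C : Set ℂ | (∃ a ∈ A, C = deltaCluster A δ a) ∧ C ⊆ closedHull W t} := by
  ext z
  constructor
  · rintro ⟨hzA, hzK⟩
    refine ⟨hzA, fun hz ↦ ?_⟩
    obtain ⟨C, ⟨-, hCK⟩, hzC⟩ := mem_sUnion.1 hz
    exact hzK (hCK hzC)
  · rintro ⟨hzA, h⟩
    refine ⟨hzA, fun hzK ↦ h (mem_sUnion.2 ⟨deltaCluster A δ z, ⟨⟨z, hzA, rfl⟩, ?_⟩, mem_deltaCluster_self A δ z⟩)⟩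
    exact hγ.deltaCluster_subset_closedHull hW hW0 hA hδ h0 hfar hzA hzK

/-- **While the curve is `δ`-far from `A` on `[0, β]`, the remaining hull takes finitely many values
there** (each is `A` minus a union of the finitely many `δ`-clusters, `finite_setOf_deltaCluster`).
[cite: Lawler2005, §6.3 Thm. 6.13] -/
theorem finite_image_remHull_of_far {β : ℝ≥0} (hfar : ∀ s ≤ β, δ ≤ infDist (γ s) A) :
    (remHull W A '' Icc 0 β).Finite := by
  set 𝒞 : Set (Set ℂ) := {C : Set ℂ | ∃ a ∈ A, C = deltaCluster A δ a} with h𝒞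
  have h𝒞fin : 𝒞.Finite := finite_setOf_deltaCluster hA.isBoundedHull.isCompact hδ
  have hsub : remHull W A '' Icc 0 β ⊆ (fun S : Set (Set ℂ) ↦ A \ ⋃₀ S) '' {S | S ⊆ 𝒞} := by
    rintro _ ⟨t, ht, rfl⟩
    refine ⟨{C : Set ℂ | (∃ a ∈ A, C = deltaCluster A δ a) ∧ C ⊆ closedHull W t}, fun C hC ↦ hC.1, ?_⟩
    exact (remHull_eq_diff_sUnion_of_far hγ hW hW0 hA hδ h0 fun s hs ↦ hfar s (hs.trans ht.2)).symm
  exact (h𝒞fin.finite_subsets.image _).subset hsub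

/-- **(D) under the `δ`-far hypothesis.** Let `W` be continuous from `0` with chain generated by `γ`,
`A` a nonempty `*`-hull, `0 < δ ≤ dist(0, A)`, and `β₂ < β` horizons with the curve `δ`-far from `A`
on `[0, β]`. If the chain of a continuous `U'` equal to `U* ∘ τ = thrImageDriverC W A β` up to `σ β₂`
is generated by `γ̂`, then `γ̂ (σ t) = E_A (γ t)` for every `t ≤ β₂`.
[cite: Lawler2005, §6.3 Thm. 6.13 (γ* = Φ ∘ γ after the time change); LawlerSchrammWerner2003Restriction, §5] -/
theorem thr_apply_clockC_eq_of_far (hne : A.Nonempty) {β β₂ : ℝ≥0} (hβ₂ : β₂ < β)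
    (hfar : ∀ s ≤ β, δ ≤ infDist (γ s) A) {U' : ℝ≥0 → ℝ} (hU' : Continuous U')
    (hagree : ∀ s, s ≤ thrClockC W A β₂ → U' s = thrImageDriverC W A β s)
    {γ' : ℝ≥0 → ℂ} (hγ' : IsGeneratedByCurve U' γ') (t : ℝ≥0) (ht : t ≤ β₂) :
    γ' (thrClockC W A t) = starMap A (γ t) := by
  have hcl : ∀ s ≤ β, IsClosed (remHull W A s) := fun s hs ↦
    hγ.isClosed_diff_closedHull hW hW0 hA hδ h0 fun r hr ↦ hfar r (hr.trans hs)
  have hfin := finite_image_remHull_of_far hγ hW hW0 hA hδ h0 hfar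
  have hγA : ∀ s ≤ β, γ s ∉ A := fun s hs hsA ↦ by
    have := hfar s hs
    rw [infDist_zero_of_mem hsA] at this
    exact absurd this (not_le.2 hδ)
  exact thr_apply_clockC_eq_of_finite hW hW0 hA hne hβ₂ hcl hfin hγ hγA hU' hagree hγ' t ht

end Far

end Loewner

end Literature.Probability.RandomPlanarGeometry

end
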